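import Mathlib
import Summits.FinalStateConjecture.FinalStateConjecture.Theorems.PhotonSphereChannelsUniformPhotonSphereChannelsRPeelSeed
import Summits.FinalStateConjecture.FinalStateConjecture.Theorems.PhotonSphereChannelsUniformPhotonSphereChannelsRPeelPrimitive

/-!
# Peeling, file 6: square integrability at every time, and of the peeled data at `t = 0`

Support file for `stub_peel` of the line `crum-peeling-recessive-tower` (crux
`UniformPhotonSphereChannelsR`, stmt-FinalStateConjecture-14074).

* `level_integrable` — a `C²` solution of `θ_tt − θ_xx + Uθ = 0` on the half-plane `{x > a}` with
  `θ_t(0,·), θ_x(0,·) ∈ L²(X, ∞)` and `θ(0,·)/x ∈ L²` (every `X > a`), `U ≥ 0` and `|x²U| ≤ C` on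
  `[X₁, ∞)`, has `θ_t(t,·), θ_x(t,·), Uθ(t,·)²` and the energy density integrable on every
  `(X, ∞)`, at EVERY time `t` (far-energy monotonicity `peel_halfPlaneFarEnergy` + continuity on
  compacts);
* `rung_initial_integrable` — the peeled function `θ̃` of a Darboux rung (`θ̃_t = θ_x − Wθ`,
  `θ̃_x = θ_t − Wθ̃`, `w θ̃(0,·) = −∫_·^∞ w θ_t(0,·)`) inherits the three `t = 0` integrability
  clauses; the clause `θ̃(0,·)/x ∈ L²` is the dual Hardy inequality `peel_hardyTail` with the seed
  decay `w(y)/w(x) ≤ (y/x)^{-3/4}`.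
-/

noncomputable section

-- the doubled `FinalStateConjecture` component is the tree's fixed summit/problem path
set_option linter.dupNamespace false

namespace Summit.FinalStateConjecture.FinalStateConjecture.Theorems.CrumPeelingRecessiveTower

open MeasureTheory Set Filter Topology intervalIntegral
open scoped ContDiff

/-- **Square integrability at every time.**  See the module docstring. -/
theorem level_integrable {a X₁ C : ℝ} {U : ℝ → ℝ} {θ : ℝ → ℝ → ℝ} (haX : a < X₁) (hX1 : 1 ≤ X₁)
    (hU : ContinuousOn U (Ioi a)) (hU0 : ∀ x, X₁ ≤ x → 0 ≤ U x)
    (hUB : ∀ x, X₁ ≤ x → |x ^ 2 * U x| ≤ C)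
    (hθ : ContDiffOn ℝ 2 (Function.uncurry θ) {z : ℝ × ℝ | a < z.2})
    (hsol : ∀ t x, a < x →
      iteratedDeriv 2 (fun τ => θ τ x) t - iteratedDeriv 2 (θ t) x + U x * θ t x = 0)
    (hI1 : ∀ X, a < X → IntegrableOn (fun x => deriv (fun τ => θ τ x) 0 ^ 2) (Ioi X))
    (hI2 : ∀ X, a < X → IntegrableOn (fun x => deriv (θ 0) x ^ 2) (Ioi X))
    (hI3 : ∀ X, a < X → 1 ≤ X → IntegrableOn (fun x => (θ 0 x / x) ^ 2) (Ioi X))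
    (t : ℝ) {X : ℝ} (hX : a < X) :
    IntegrableOn (fun x => deriv (fun τ => θ τ x) t ^ 2) (Ioi X) ∧
    IntegrableOn (fun x => deriv (θ t) x ^ 2) (Ioi X) ∧
    IntegrableOn (fun x => U x * θ t x ^ 2) (Ioi X) ∧
    IntegrableOn (fun x =>
      deriv (fun τ => θ τ x) t ^ 2 + deriv (θ t) x ^ 2 + U x * θ t x ^ 2) (Ioi X) := by
  obtain ⟨dt, dx, -, -, -, hct, hcx, -, -, -, -, -, h1, h2, -, -, -, -, -, -⟩ :=
    halfPlane_partials hθ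
  -- continuity of the slices on `(a, ∞)`
  have hθc : ∀ s, ContinuousOn (θ s) (Ioi a) := fun s => continuousOn_slice_snd hθ.continuousOn s
  have hdtc : ∀ s, ContinuousOn (fun x => deriv (fun τ => θ τ x) s) (Ioi a) := fun s =>
    (continuousOn_slice_snd hct s).congr fun x hx => (h1 s x hx).deriv
  have hdxc : ∀ s, ContinuousOn (fun x => deriv (θ s) x) (Ioi a) := fun s =>
    (continuousOn_slice_snd hcx s).congr fun x hx => (h2 s x hx).deriv
  have hUθc : ∀ s, ContinuousOn (fun x => U x * θ s x ^ 2) (Ioi a) := fun s => hU.mul ((hθc s).pow 2)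
  have hec : ∀ s, ContinuousOn (fun x =>
      deriv (fun τ => θ τ x) s ^ 2 + deriv (θ s) x ^ 2 + U x * θ s x ^ 2) (Ioi a) := fun s =>
    (((hdtc s).pow 2).add ((hdxc s).pow 2)).add (hUθc s)
  -- the initial energy on `(X₁, ∞)` is finite
  have hX₁0 : 0 < X₁ := by linarith
  have hUθ0 : IntegrableOn (fun x => U x * θ 0 x ^ 2) (Ioi X₁) := by
    have hdom : IntegrableOn (fun x => C * (θ 0 x / x) ^ 2) (Ioi X₁) := (hI3 X₁ haX hX1).const_mul C
    refine hdom.mono' ((hUθc 0).mono (Ioi_subset_Ioi haX.le) |>.aestronglyMeasurable measurableSet_Ioi) ?_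
    filter_upwards [ae_restrict_mem measurableSet_Ioi] with x hx
    have hx0 : 0 < x := hX₁0.trans hx
    have hb := hUB x (le_of_lt hx)
    rw [Real.norm_eq_abs, abs_mul, abs_of_nonneg (sq_nonneg (θ 0 x))]
    have e : |U x| * θ 0 x ^ 2 = |x ^ 2 * U x| * (θ 0 x / x) ^ 2 := by
      rw [abs_mul, abs_of_nonneg (sq_nonneg x)]
      field_simp
    rw [e]
    exact mul_le_mul_of_nonneg_right hb (sq_nonneg _)
  have he0 : IntegrableOn (fun x =>
      deriv (fun τ => θ τ x) 0 ^ 2 + deriv (θ 0) x ^ 2 + U x * θ 0 x ^ 2) (Ioi X₁) :=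
    ((hI1 X₁ haX).add (hI2 X₁ haX)).add hUθ0
  have he0nn : ∀ s x, X₁ ≤ x → 0 ≤ deriv (fun τ => θ τ x) s ^ 2 + deriv (θ s) x ^ 2 + U x * θ s x ^ 2 :=
    fun s x hx => by have := hU0 x hx; positivity
  have hfin0 : ∫⁻ x in Ioi X₁, ENNReal.ofReal
      (deriv (fun τ => θ τ x) 0 ^ 2 + deriv (θ 0) x ^ 2 + U x * θ 0 x ^ 2) ≠ ⊤ := by
    rw [lintegral_eq_ofReal_of_integrableOn measurableSet_Ioi he0 fun x hx => he0nn 0 x (le_of_lt hx)]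
    exact ENNReal.ofReal_ne_top
  -- energy monotonicity along the receding edge
  have hmono := halfPlane_farEnergy_le_initial haX hU hU0 hθ hsol (c := X₁) le_rfl t
  have hfint : ∫⁻ x in Ioi (X₁ + |t|), ENNReal.ofReal
      (deriv (fun τ => θ τ x) t ^ 2 + deriv (θ t) x ^ 2 + U x * θ t x ^ 2) ≠ ⊤ :=
    ne_top_of_le_ne_top hfin0 hmono
  have hXt : a < X₁ + |t| := by have := abs_nonneg t; linarith
  have het : IntegrableOn (fun x =>
      deriv (fun τ => θ τ x) t ^ 2 + deriv (θ t) x ^ 2 + U x * θ t x ^ 2) (Ioi (X₁ + |t|)) :=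
    (integrableOn_of_lintegral_ne_top
      (((hec t).mono (Ioi_subset_Ioi hXt.le)).aestronglyMeasurable measurableSet_Ioi)
      (fun x hx => he0nn t x (by have := abs_nonneg t; linarith [mem_Ioi.1 hx]))
      measurableSet_Ioi hfint).1
  -- the pieces beyond `X₁ + |t|`
  have hp1 : IntegrableOn (fun x => deriv (fun τ => θ τ x) t ^ 2) (Ioi (X₁ + |t|)) :=
    integrableOn_sq_of_le hXt.le (hdtc t) het fun x hx => by
      have := hU0 x (by have := abs_nonneg t; linarith); nlinarith [sq_nonneg (deriv (θ t) x)]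
  have hp2 : IntegrableOn (fun x => deriv (θ t) x ^ 2) (Ioi (X₁ + |t|)) :=
    integrableOn_sq_of_le hXt.le (hdxc t) het fun x hx => by
      have := hU0 x (by have := abs_nonneg t; linarith)
      nlinarith [sq_nonneg (deriv (fun τ => θ τ x) t)]
  have hp3 : IntegrableOn (fun x => U x * θ t x ^ 2) (Ioi (X₁ + |t|)) := by
    refine het.mono' (((hUθc t).mono (Ioi_subset_Ioi hXt.le)).aestronglyMeasurable
      measurableSet_Ioi) ?_
    filter_upwards [ae_restrict_mem measurableSet_Ioi] with x hx
    have h0 := hU0 x (by have := abs_nonneg t; linarith [mem_Ioi.1 hx])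
    rw [Real.norm_eq_abs, abs_of_nonneg (by positivity)]
    nlinarith [sq_nonneg (deriv (fun τ => θ τ x) t), sq_nonneg (deriv (θ t) x)]
  -- glue down to `X`
  have glue : ∀ {f : ℝ → ℝ}, ContinuousOn f (Ioi a) → IntegrableOn f (Ioi (X₁ + |t|)) →
      IntegrableOn f (Ioi X) := by
    intro f hfc hfi
    rcases le_or_gt (X₁ + |t|) X with h | h
    · exact hfi.mono_set (Ioi_subset_Ioi h)
    · exact integrableOn_Ioi_of_continuousOn_Icc (hfc.mono fun x hx => lt_of_lt_of_le hX hx.1) hfi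
  exact ⟨glue ((hdtc t).pow 2) hp1, glue ((hdxc t).pow 2) hp2, glue (hUθc t) hp3, glue (hec t) het⟩

/-- **The peeled data at `t = 0` are square integrable.**  See the module docstring. -/
theorem rung_initial_integrable {a X₁ B : ℝ} {W w : ℝ → ℝ} {θ θn : ℝ → ℝ → ℝ}
    (haX : a < X₁) (hX1 : 1 ≤ X₁)
    (hrec : ∀ x, X₁ ≤ x → x * W x ≤ -3 / 4) (hWB : ∀ x, X₁ ≤ x → |x * W x| ≤ B)
    (hw0 : ∀ x, a < x → 0 < w x) (hwd : ∀ x, a < x → HasDerivAt w (W x * w x) x)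
    (hθ : ContDiffOn ℝ 2 (Function.uncurry θ) {z : ℝ × ℝ | a < z.2})
    (hθn : ContDiffOn ℝ 2 (Function.uncurry θn) {z : ℝ × ℝ | a < z.2})
    (hRt : ∀ x, a < x → deriv (fun τ => θn τ x) 0 = deriv (θ 0) x - W x * θ 0 x)
    (hRx : ∀ x, a < x → deriv (θn 0) x = deriv (fun τ => θ τ x) 0 - W x * θn 0 x)
    (hwi : ∀ X, a < X → IntegrableOn (fun y => w y * deriv (fun τ => θ τ y) 0) (Ioi X))
    (htail : ∀ x, a < x → w x * θn 0 x = -∫ y in Ioi x, w y * deriv (fun τ => θ τ y) 0)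
    (hI1 : ∀ X, a < X → IntegrableOn (fun x => deriv (fun τ => θ τ x) 0 ^ 2) (Ioi X))
    (hI2 : ∀ X, a < X → IntegrableOn (fun x => deriv (θ 0) x ^ 2) (Ioi X))
    (hI3 : ∀ X, a < X → 1 ≤ X → IntegrableOn (fun x => (θ 0 x / x) ^ 2) (Ioi X)) :
    (∀ X, a < X → IntegrableOn (fun x => deriv (fun τ => θn τ x) 0 ^ 2) (Ioi X)) ∧
    (∀ X, a < X → IntegrableOn (fun x => deriv (θn 0) x ^ 2) (Ioi X)) ∧
    (∀ X, a < X → 1 ≤ X → IntegrableOn (fun x => (θn 0 x / x) ^ 2) (Ioi X)) := by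
  have hX₁0 : 0 < X₁ := by linarith
  obtain ⟨dt, -, -, -, -, hct, -, -, -, -, -, -, h1, -, -, -, -, -, -, -⟩ := halfPlane_partials hθ
  obtain ⟨dtn, dxn, -, -, -, hctn, hcxn, -, -, -, -, -, h1n, h2n, -, -, -, -, -, -⟩ :=
    halfPlane_partials hθn
  have hθc : ContinuousOn (θ 0) (Ioi a) := continuousOn_slice_snd hθ.continuousOn 0
  have hθnc : ContinuousOn (θn 0) (Ioi a) := continuousOn_slice_snd hθn.continuousOn 0
  have hfc : ContinuousOn (fun x => deriv (fun τ => θ τ x) 0) (Ioi a) :=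
    (continuousOn_slice_snd hct 0).congr fun x hx => (h1 0 x hx).deriv
  have hdtnc : ContinuousOn (fun x => deriv (fun τ => θn τ x) 0) (Ioi a) :=
    (continuousOn_slice_snd hctn 0).congr fun x hx => (h1n 0 x hx).deriv
  have hdxnc : ContinuousOn (fun x => deriv (θn 0) x) (Ioi a) :=
    (continuousOn_slice_snd hcxn 0).congr fun x hx => (h2n 0 x hx).deriv
  -- glue from a far threshold down to any `X > a`
  have glue : ∀ {f : ℝ → ℝ} {X X' : ℝ}, a < X → ContinuousOn f (Ioi a) → IntegrableOn f (Ioi X') →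
      IntegrableOn f (Ioi X) := by
    intro f X X' hX hfc' hfi
    rcases le_or_gt X' X with h | h
    · exact hfi.mono_set (Ioi_subset_Ioi h)
    · exact integrableOn_Ioi_of_continuousOn_Icc (hfc'.mono fun x hx => lt_of_lt_of_le hX hx.1) hfi
  -- (i) `θn(0,·)/x ∈ L²` beyond `X₁` by the dual Hardy inequality
  set f : ℝ → ℝ := fun x => deriv (fun τ => θ τ x) 0 with hf
  set Φ : ℝ → ℝ := fun x => ∫ y in Ioi x, y ^ (-(3 : ℝ) / 4) * |f y| with hΦ
  have hfX₁ : ContinuousOn f (Ici X₁) := hfc.mono fun x hx => lt_of_lt_of_le haX hx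
  obtain ⟨hρf, -⟩ := hardy_tail_pointwise hX₁0 hfX₁ (hI1 X₁ haX)
  obtain ⟨hHardy, -⟩ := hardy_tail hX₁0 hfX₁ (hI1 X₁ haX)
  have hpt : ∀ x, X₁ ≤ x → |θn 0 x| ≤ x ^ ((3 : ℝ) / 4) * Φ x := by
    intro x hx
    have hxa : a < x := haX.trans_le hx
    have hx0 : 0 < x := hX₁0.trans_le hx
    have hwx := hw0 x hxa
    -- `|∫ w f| ≤ ∫ |w f| ≤ w(x) x^{3/4} Φ(x)`
    have hint1 : |∫ y in Ioi x, w y * f y| ≤ ∫ y in Ioi x, |w y * f y| := abs_integral_le_integral_abs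
    have hint2 : ∫ y in Ioi x, |w y * f y|
        ≤ ∫ y in Ioi x, (w x * x ^ ((3 : ℝ) / 4)) * (y ^ (-(3 : ℝ) / 4) * |f y|) := by
      refine setIntegral_mono_on ((hwi x hxa).abs) ((hρf.mono_set (Ioi_subset_Ioi hx)).const_mul _)
        measurableSet_Ioi fun y hy => ?_
      have hy0 : 0 < y := hx0.trans hy
      have hratio := seed_ratio_le haX hX₁0 hw0 hwd hrec hx (le_of_lt hy)
      have e : (y / x) ^ (-(3 : ℝ) / 4) = x ^ ((3 : ℝ) / 4) * y ^ (-(3 : ℝ) / 4) := by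
        rw [show (-(3 : ℝ) / 4) = -((3 : ℝ) / 4) by ring, Real.div_rpow hy0.le hx0.le,
          Real.rpow_neg hx0.le, div_inv_eq_mul, mul_comm]
      rw [abs_mul, abs_of_pos (hw0 y (hxa.trans hy))]
      calc w y * |f y| ≤ (w x * (y / x) ^ (-(3 : ℝ) / 4)) * |f y| :=
            mul_le_mul_of_nonneg_right hratio (abs_nonneg _)
        _ = (w x * x ^ ((3 : ℝ) / 4)) * (y ^ (-(3 : ℝ) / 4) * |f y|) := by rw [e]; ring
    rw [MeasureTheory.integral_const_mul] at hint2
    have hkey : w x * |θn 0 x| ≤ w x * (x ^ ((3 : ℝ) / 4) * Φ x) := by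
      calc w x * |θn 0 x| = |w x * θn 0 x| := by rw [abs_mul, abs_of_pos hwx]
        _ = |∫ y in Ioi x, w y * f y| := by rw [htail x hxa, abs_neg]
        _ ≤ (w x * x ^ ((3 : ℝ) / 4)) * Φ x := hint1.trans hint2
        _ = w x * (x ^ ((3 : ℝ) / 4) * Φ x) := by ring
    exact le_of_mul_le_mul_left hkey hwx
  have hi_far : IntegrableOn (fun x => (θn 0 x / x) ^ 2) (Ioi X₁) := by
    have hcont : ContinuousOn (fun x => θn 0 x / x) (Ioi a ∩ Ioi 0) :=
      (hθnc.mono inter_subset_left).div (continuousOn_id.mono inter_subset_right)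
        fun x hx => (ne_of_gt hx.2)
    refine hHardy.mono' ?_ ?_
    · exact ((hcont.mono fun x hx => ⟨haX.trans hx, hX₁0.trans hx⟩).pow 2).aestronglyMeasurable
        measurableSet_Ioi
    · filter_upwards [ae_restrict_mem measurableSet_Ioi] with x hx
      have hx0 : 0 < x := hX₁0.trans hx
      have hp := hpt x (le_of_lt hx)
      have hΦ0 : 0 ≤ Φ x := setIntegral_nonneg measurableSet_Ioi fun y hy =>
        mul_nonneg (Real.rpow_nonneg (hx0.trans hy).le _) (abs_nonneg _)
      rw [Real.norm_eq_abs, abs_of_nonneg (sq_nonneg _), div_pow]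
      rw [div_le_iff₀ (by positivity)]
      have e : x ^ (-(1 : ℝ) / 2) * Φ x ^ 2 * x ^ 2 = (x ^ ((3 : ℝ) / 4) * Φ x) ^ 2 := by
        have h34 : x ^ ((3 : ℝ) / 4) = x ^ (-(1 : ℝ) / 4) * x := by
          rw [← Real.rpow_add_one hx0.ne']; norm_num
        rw [h34, show (x ^ (-(1 : ℝ) / 4) * x * Φ x) ^ 2 = (x ^ (-(1 : ℝ) / 4)) ^ 2 * Φ x ^ 2 * x ^ 2
          by ring, rpow_neg_quarter_sq hx0]
      rw [e, ← sq_abs (θn 0 x)]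
      exact pow_le_pow_left₀ (abs_nonneg _) hp 2
  have hcont3 : ContinuousOn (fun x => (θn 0 x / x) ^ 2) (Ioi (max a 0)) :=
    ((hθnc.mono fun x hx => (max_lt_iff.1 hx).1).div continuousOn_id
      fun x hx => (ne_of_gt (max_lt_iff.1 hx).2)).pow 2
  have h3 : ∀ X, a < X → 1 ≤ X → IntegrableOn (fun x => (θn 0 x / x) ^ 2) (Ioi X) := by
    intro X hX hX1'
    rcases le_or_gt X₁ X with h | h
    · exact hi_far.mono_set (Ioi_subset_Ioi h)
    · refine integrableOn_Ioi_of_continuousOn_Icc (hcont3.mono fun x hx => ?_) hi_far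
      exact max_lt hX (by linarith) |>.trans_le hx.1
  -- (ii), (iii): the first partials at `t = 0`
  have hWsq : ∀ x, X₁ ≤ x → ∀ v : ℝ, (W x * v) ^ 2 ≤ B ^ 2 * (v / x) ^ 2 := by
    intro x hx v
    have hx0 : 0 < x := hX₁0.trans_le hx
    have hb := hWB x hx
    have e : (W x * v) ^ 2 = (x * W x) ^ 2 * (v / x) ^ 2 := by field_simp
    rw [e, ← sq_abs (x * W x)]
    exact mul_le_mul_of_nonneg_right (pow_le_pow_left₀ (abs_nonneg _) hb 2) (sq_nonneg _)
  refine ⟨fun X hX => ?_, fun X hX => ?_, h3⟩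
  · have hfar : IntegrableOn (fun x => deriv (fun τ => θn τ x) 0 ^ 2) (Ioi X₁) := by
      refine integrableOn_sq_of_le haX.le hdtnc
        (((hI2 X₁ haX).const_mul 2).add (((hI3 X₁ haX hX1).const_mul (B ^ 2)).const_mul 2))
        fun x hx => ?_
      simp only [Pi.add_apply]
      rw [hRt x (haX.trans hx)]
      have h := hWsq x (le_of_lt hx) (θ 0 x)
      nlinarith [sq_nonneg (deriv (θ 0) x + W x * θ 0 x)]
    exact glue hX (hdtnc.pow 2) hfar
  · have hfar : IntegrableOn (fun x => deriv (θn 0) x ^ 2) (Ioi X₁) := by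
      refine integrableOn_sq_of_le haX.le hdxnc
        (((hI1 X₁ haX).const_mul 2).add ((hi_far.const_mul (B ^ 2)).const_mul 2))
        fun x hx => ?_
      simp only [Pi.add_apply]
      rw [hRx x (haX.trans hx)]
      have h := hWsq x (le_of_lt hx) (θn 0 x)
      nlinarith [sq_nonneg (deriv (fun τ => θ τ x) 0 + W x * θn 0 x)]
    exact glue hX (hdxnc.pow 2) hfar

/-- Registered sub-goal `peel_levelIntegrable` of `stub_peel` (verbatim signature): energy integrability at every time for a half-plane solution with square-integrable data at `t = 0`. -/
theorem peel_levelIntegrable : ∀ (a X₁ C : ℝ) (U : ℝ → ℝ) (θ : ℝ → ℝ → ℝ), a < X₁ → 1 ≤ X₁ → ContinuousOn U (Set.Ioi a) → (∀ x, X₁ ≤ x → 0 ≤ U x) → (∀ x, X₁ ≤ x → |x ^ 2 * U x| ≤ C) → ContDiffOn ℝ 2 (Function.uncurry θ) {z : ℝ × ℝ | a < z.2} → (∀ t x, a < x → iteratedDeriv 2 (fun τ => θ τ x) t - iteratedDeriv 2 (θ t) x + U x * θ t x = 0) → (∀ X, a < X → MeasureTheory.IntegrableOn (fun x => deriv (fun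 τ => θ τ x) 0 ^ 2) (Set.Ioi X)) → (∀ X, a < X → MeasureTheory.IntegrableOn (fun x => deriv (θ 0) x ^ 2) (Set.Ioi X)) → (∀ X, a < X → 1 ≤ X → MeasureTheory.IntegrableOn (fun x => (θ 0 x / x) ^ 2) (Set.Ioi X)) → ∀ (t X : ℝ), a < X → MeasureTheory.IntegrableOn (fun x => deriv (fun τ => θ τ x) t ^ 2 + deriv (θ t) x ^ 2 + U x * θ t x ^ 2) (Set.Ioi X) :=
  fun _ _ _ _ _ haX hX1 hU hU0 hUB hθ hsol hI1 hI2 hI3 t _ hX => (level_integrable haX hX1 hU hU0 hUB hθ hsol hI1 hI2 hI3 t hX).2.2.2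

end Summit.FinalStateConjecture.FinalStateConjecture.Theorems.CrumPeelingRecessiveTower
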